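import Summits.BirchSwinnertonDyer.BirchSwinnertonDyer.Theses.KolyvaginRankRigidityAtTwo
import HarnessLib

/-!
# TURNKEY (lead krr2-p1 g7) for the pen of route `KolyvaginRankRigidityAtTwo` — recommendation R4-θ:
# the margin restatement of the pair (V1′, V2♭) at `p = 2` with KOLYVAGIN'S RELATIVE MARGIN
# `θ·M + k ≤ M(n)` (Math. Ann. 291, p. 257: "2m(λ₀) < n(λ₀)", "θ m_f < m(p₀), θ = 2 or 3"), deciding theorem re-checked

WHY (supersedes the additive form `M + k ≤ M(n)` of `MARGIN_RESTATEMENT_R4.lean`, see the crux-dir memo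
`MARGIN_THETA.md`). Kolyvagin runs the theory of [1] from a GENERAL base conductor `λ₀` (one whose primes
are not chosen by the prover — exactly the situation of V2♭'s hypothesis, whose seed conductor `n₀` is
given) only under the RELATIVE condition `2·m(λ₀) < n(λ₀)` (divisibility less than half the index), resp.
`θ·m_f < m(p₀)`, `θ = 2` or `3` (Math. Ann. 291 (1991) p. 257, verbatim). The reason is visible in the
prime-swap step ([1, Prop. 8] = McCallum 1991 Prop. 5.2's proof = W. Zhang 2014 Lemma 8.4's induction at
level `p^M`): the auxiliary class ramified at the prime `λ₀` being swapped OUT exists with transverse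
order `2^{a}` exactly when the Selmer-type group transverse at the other window primes localises at `λ₀`
with defect `a` (signed Poitou–Tate count: the two orders multiply to `2^{M ± O(1)}`), and for an
ARBITRARY `λ₀` the defect `a` can be `≈ M/2`; the reciprocity identity is then informative only if the
class being propagated has order `> 2^{M/2 + O(1)}` at the working level, i.e. index `> 2·divisibility +
O(1)`. An additive margin `M₀ + k ≤ M(n₀)` (R4 as first typed) only gives index `≥ divisibility + 1 + k`,
and minimality among margin-`k` classes does not let the prover trade the given seed for a better one.
With the relative margin the swap at `2` is LOSSLESS in the currency "maximal local order at a fresh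
Kolyvagin prime" for BOTH signs of `Δ_E` (the `Δ < 0` pairing bit and the `Δ > 0` Frobenius-square bit
are symmetric between the `λ'`- and `λ₀`-terms of the reciprocity law and cancel), so the relative order
`> 1/2` is an invariant of the whole induction and `θ = 2`, `k = O(1)` suffice; `∃ θ k` / `∀ θ k` is the
robust typing (the prover of V2♭ chooses, V1′ supplies for all — any proof of Kolyvagin's conjecture at `2`
giving bounded divisibility at unbounded index supplies every `θ, k`).

* `KolyvaginNonvanishingAtTwoFrameTheta` (V1′θ) = V1′ with `∀ θ k, ∃` a non-zero class `c_M(n)` with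
  `θ·M + k ≤ M(n)`;
* `KolyvaginCorankLowerBoundAtTwoTheta` (V2♭θ) = V2♭ with `∃ θ k` such that the lower bound holds for
  non-zero classes with `θ·M + k ≤ M(n)` that are depth-minimal AMONG such classes.

`closes_theta` is the route's deciding theorem `closes` VERBATIM with (V1′, V2♭) replaced by (V1′θ, V2♭θ):
it still concludes the leaf `Rank1Residual.NonCMTwoConverse`. `frame_of_theta`: V1′θ ⇒ V1′ (as filed).
V2♭θ is NOT formally comparable with V2♭ (minimality is among a smaller class set); it is what Kolyvagin's
Thm. 2.2 asserts for a general base. This file is EVIDENCE for a route edit (items are the planner's,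
D-0014); it defines the two candidate texts locally and is not a Theorems landing. BSD is not proved by
any of this.
-/

set_option linter.dupNamespace false

namespace Summit.BirchSwinnertonDyer.BirchSwinnertonDyer.Theses.KolyvaginRankRigidityAtTwo.MarginThetaTurnkey

open scoped BigOperators Classical
open Summit.BirchSwinnertonDyer.BirchSwinnertonDyer.Theses.KolyvaginRankRigidityAtTwo Literature

/-- **V1′θ — Kolyvagin's conjecture at `2` in RELATIVE-MARGIN form** (candidate replacement text for
item 24622 `KolyvaginNonvanishingAtTwoFrame`): for every `θ, k` there is a non-zero class `c_M(n)` with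
`θ·M + k ≤ M(n)` — a non-zero class whose Kolyvagin index exceeds `θ` times its level (so `θ` times its
divisibility) by `k`; supplied for all `θ, k` by bounded divisibility at unbounded index (Kolyvagin's
strong non-zero systems, Conj. 2.5, and his base condition `θ·m(λ₀) < n(λ₀)`).
[cite: Kolyvagin1991MathAnn, p. 257 (2m(λ₀) < n(λ₀); θ m_f < m(p₀), θ = 2 or 3), p. 259 (Conj. 2.5)] -/
def KolyvaginNonvanishingAtTwoFrameTheta : Prop :=
  ∀ (W : WeierstrassCurve ℚ) [W.IsElliptic] [W.IsGloballyMinimal], ¬ W.HasCM → (Literature.NumberTheory.EllipticCurves.Rank1Residual.GoodOrd W 2 ∨ Literature.NumberTheory.EllipticCurves.Rank1Residual.Mult W 2) → (∀ m : ℕ, W.HasSurjectiveModNGaloisRep (2 ^ m : ℕ)) → ∀ (K : Type) [Field K] [NumberField K], Literature.NumberTheory.EllipticCurves.IsImaginaryQuadratic K → ∀ [NeZero (W.conductorNorm ℤ)], Literature.NumberTheory.EllipticCurves.SatisfiesHeegnerHypothesis (W.conductorNorm ℤ) K → Odd (NumberField.discr K) → NumberField.discr K ≠ -3 → AddSubgroup.torsionBy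 (W.baseChange K).toAffine.Point (2 : ℤ) = ⊥ → Literature.NumberTheory.EllipticCurves.SatisfiesHeegnerHypothesis 2 K → ∀ (Dt : Literature.NumberTheory.EllipticCurves.ModularForms.ModularParametrizationData W (W.conductorNorm ℤ)) (β : ℤ) (ι : K →+* ℂ), (4 * (W.conductorNorm ℤ : ℤ)) ∣ β ^ 2 - NumberField.discr K → ∀ θ k : ℕ, ∃ (n : ℕ) (d : Literature.NumberTheory.EllipticCurves.KolyvaginHeegnerData Dt β ι n) (M : ℕ), Literature.NumberTheory.EllipticCurves.KolyvaginDescent.KolSupp (Literature.NumberTheory.EllipticCurves.Zhang2014.IsKolyvaginPrime (W.conductorNorm ℤ) W K 2) n ∧ 1 ≤ M ∧ ((θ * M + k : ℕ) : ℕ∞) ≤ Literature.NumberTheory.EllipticCurves.Zhang2014.levelIndex W 2 n ∧ d.kolyvaginClass Nat.prime_two M ≠ 0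

/-- **V2♭θ — the corank lower bound at `2` for classes WITH RELATIVE MARGIN** (candidate replacement
text for item 24623 `KolyvaginCorankLowerBoundAtTwo`): for some `θ, k` (depending on the curve and the
field; `θ = 2`, `k = O(1)` expected), a non-zero class `c_M(n)` with `θ·M + k ≤ M(n)` whose depth is
minimal among such classes has `ν + 1 ≤ c ∨ ν + 1 ≤ c'` — Kolyvagin's Thm. 2.2 for a general base `p₀`
under `θ m_f < m(p₀)`, at the prime `2`. [cite: Kolyvagin1991MathAnn, §2 Thm. 2.2–2.3 and p. 257] -/
def KolyvaginCorankLowerBoundAtTwoTheta : Prop :=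
  ∀ (W : WeierstrassCurve ℚ) [W.IsElliptic] [W.IsGloballyMinimal], ¬ W.HasCM → (Literature.NumberTheory.EllipticCurves.Rank1Residual.GoodOrd W 2 ∨ Literature.NumberTheory.EllipticCurves.Rank1Residual.Mult W 2) → (∀ m : ℕ, W.HasSurjectiveModNGaloisRep (2 ^ m : ℕ)) → ∀ (K : Type) [Field K] [NumberField K], Literature.NumberTheory.EllipticCurves.IsImaginaryQuadratic K → NumberField.discr K ≠ -3 → NumberField.discr K ≠ -4 → ¬ ((2 : ℤ) ∣ NumberField.discr K) → ∀ [NeZero (W.conductorNorm ℤ)], Literature.NumberTheory.EllipticCurves.SatisfiesHeegnerHypothesis (W.conductorNorm ℤ) K → ∃ θ k : ℕ, ∀ (Dt : Literature.NumberTheory.EllipticCurves.ModularForms.ModularParametrizationData W (W.conductorNorm ℤ)) (β : ℤ) (ι : K →+* ℂ) (n : ℕ) (d : Literature.NumberTheory.EllipticCurves.KolyvaginHeegnerData Dt β ι n) (M : ℕ), Literature.NumberTheory.EllipticCurves.KolyvaginDescent.KolSupp (Literature.NumberTheory.EllipticCurves.Zhang2014.IsKolyvaginPrime (W.conductorNorm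 ℤ) W K 2) n → 1 ≤ M → ((θ * M + k : ℕ) : ℕ∞) ≤ Literature.NumberTheory.EllipticCurves.Zhang2014.levelIndex W 2 n → d.kolyvaginClass Nat.prime_two M ≠ 0 → (∀ (n' : ℕ) (d' : Literature.NumberTheory.EllipticCurves.KolyvaginHeegnerData Dt β ι n') (M' : ℕ), Literature.NumberTheory.EllipticCurves.KolyvaginDescent.KolSupp (Literature.NumberTheory.EllipticCurves.Zhang2014.IsKolyvaginPrime (W.conductorNorm ℤ) W K 2) n' → 1 ≤ M' → ((θ * M' + k : ℕ) : ℕ∞) ≤ Literature.NumberTheory.EllipticCurves.Zhang2014.levelIndex W 2 n' → d'.kolyvaginClass Nat.prime_two M' ≠ 0 → n.primeFactors.card ≤ n'.primeFactors.card) → (n.primeFactors.card + 1 ≤ W.selmerCorank 2 ∨ n.primeFactors.card + 1 ≤ (W.quadraticTwist (NumberField.discr K : ℚ)).selmerCorank 2)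

/-- V1′θ implies V1′ (as filed) (take `θ = 1`, `k = 0`): the restatement is a STRENGTHENING of the
non-vanishing crux. [cite: Kolyvagin1991MathAnn, p. 257 and p. 259] -/
theorem frame_of_theta (h : KolyvaginNonvanishingAtTwoFrameTheta) :
    KolyvaginNonvanishingAtTwoFrame := by
  intro W _ _ hCM hred hsur K _ _ hK _ hHN hodd hne3 htor hH2 Dt β ι hβ
  obtain ⟨n, d, M, hn, hM1, hMle, hne⟩ := h W hCM hred hsur K hK hHN hodd hne3 htor hH2 Dt β ι hβ 1 0
  exact ⟨n, d, M, hn, hM1, by simpa using hMle, hne⟩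

/-- A non-zero class of relative margin `(θ, k)` of MINIMAL depth among the non-zero classes of
relative margin `(θ, k)` (well-ordering of `ℕ`; variant of `heegnerSystem_exists_minimal_kolyvaginClass_ne_zero`).
[folklore] -/
theorem exists_minimal_kolyvaginClass_ne_zero_theta {W : WeierstrassCurve ℚ}
    [W.IsGloballyMinimal] [NeZero (W.conductorNorm ℤ)] {K : Type} [Field K] [NumberField K]
    {Dt : Literature.NumberTheory.EllipticCurves.ModularForms.ModularParametrizationData W (W.conductorNorm ℤ)}
    {β : ℤ} {ι : K →+* ℂ} (θ k : ℕ) {n : ℕ}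
    (d : Literature.NumberTheory.EllipticCurves.KolyvaginHeegnerData Dt β ι n) {M : ℕ}
    (hn : Literature.NumberTheory.EllipticCurves.KolyvaginDescent.KolSupp
      (Literature.NumberTheory.EllipticCurves.Zhang2014.IsKolyvaginPrime (W.conductorNorm ℤ) W K 2) n)
    (hM : 1 ≤ M)
    (hMle : ((θ * M + k : ℕ) : ℕ∞) ≤ Literature.NumberTheory.EllipticCurves.Zhang2014.levelIndex W 2 n)
    (hne : d.kolyvaginClass Nat.prime_two M ≠ 0) :
    ∃ (n₀ : ℕ) (d₀ : Literature.NumberTheory.EllipticCurves.KolyvaginHeegnerData Dt β ι n₀) (M₀ : ℕ),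
      Literature.NumberTheory.EllipticCurves.KolyvaginDescent.KolSupp
        (Literature.NumberTheory.EllipticCurves.Zhang2014.IsKolyvaginPrime (W.conductorNorm ℤ) W K 2) n₀ ∧
      1 ≤ M₀ ∧ ((θ * M₀ + k : ℕ) : ℕ∞) ≤ Literature.NumberTheory.EllipticCurves.Zhang2014.levelIndex W 2 n₀ ∧
      d₀.kolyvaginClass Nat.prime_two M₀ ≠ 0 ∧
      ∀ (n' : ℕ) (d' : Literature.NumberTheory.EllipticCurves.KolyvaginHeegnerData Dt β ι n') (M' : ℕ),
        Literature.NumberTheory.EllipticCurves.KolyvaginDescent.KolSupp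
          (Literature.NumberTheory.EllipticCurves.Zhang2014.IsKolyvaginPrime (W.conductorNorm ℤ) W K 2) n' →
        1 ≤ M' → ((θ * M' + k : ℕ) : ℕ∞) ≤ Literature.NumberTheory.EllipticCurves.Zhang2014.levelIndex W 2 n' →
        d'.kolyvaginClass Nat.prime_two M' ≠ 0 → n₀.primeFactors.card ≤ n'.primeFactors.card := by
  let P : ℕ → Prop := fun c ↦ ∃ (n' : ℕ)
    (d' : Literature.NumberTheory.EllipticCurves.KolyvaginHeegnerData Dt β ι n') (M' : ℕ),
    Literature.NumberTheory.EllipticCurves.KolyvaginDescent.KolSupp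
      (Literature.NumberTheory.EllipticCurves.Zhang2014.IsKolyvaginPrime (W.conductorNorm ℤ) W K 2) n' ∧
      1 ≤ M' ∧ ((θ * M' + k : ℕ) : ℕ∞) ≤ Literature.NumberTheory.EllipticCurves.Zhang2014.levelIndex W 2 n' ∧
      d'.kolyvaginClass Nat.prime_two M' ≠ 0 ∧ n'.primeFactors.card = c
  have hex : ∃ c, P c := ⟨_, n, d, M, hn, hM, hMle, hne, rfl⟩
  obtain ⟨n₀, d₀, M₀, hn₀, hM₀, hM₀le, hne₀, hk₀⟩ := Nat.find_spec hex
  refine ⟨n₀, d₀, M₀, hn₀, hM₀, hM₀le, hne₀, fun n' d' M' hn' hM' hM'le hne' ↦ ?_⟩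
  rw [hk₀]
  exact Nat.find_min' hex ⟨n', d', M', hn', hM', hM'le, hne', rfl⟩

/-- **The deciding theorem with the relative-margin pair** — the route's `closes` VERBATIM except that
V1′θ supplies a class of the relative margin `(θ, k)` that V2♭θ asks for, and minimality is taken among
such classes. It concludes the registered leaf `Rank1Residual.NonCMTwoConverse`.
[cite: Kolyvagin1991MathAnn, §2] [cite: GrossZagier1986, I (6.1)] -/
theorem closes_theta (hV1 : KolyvaginNonvanishingAtTwoFrameTheta)
    (hV2 : KolyvaginCorankLowerBoundAtTwoTheta)
    (hR : OffHabitatNonSurjTwoConverse) (hIn : PrintedInputsRankOneAtTwo) (hT : NoTwoTorsionOverK)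
    (hf : BFHTwistSupply) (h0 : SimpleZeroTwistSplitAtTwoOfBFH) (hGZK : MultPublishedInputsAtTwo)
    (hMod : NewformOfEllipticCurve) (hHLT : HoffsteinLuoNonvanishingTwist) (hEnt : EntireLFunctionRat) :
    Summit.BirchSwinnertonDyer.BirchSwinnertonDyer.Rank1Residual.NonCMTwoConverse := by
  have hBFH : SimpleZeroTwistSplitAtTwo := h0 hf
  intro W _ _ hCM hred r hr hc
  by_cases hsur : (∀ m : ℕ, W.HasSurjectiveModNGaloisRep (2 ^ m : ℕ))
  swap
  · exact hR W hCM hred r hr hc hsur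
  obtain ⟨-, -, hpar, hKato, -, hGZ, hrec⟩ := hIn
  have hmod : Literature.NumberTheory.EllipticCurves.ModularForms.exists_isNewformOf := hMod
  have hHL : Literature.NumberTheory.EllipticCurves.HoffsteinLuo1997_exists_twist_L_one_ne_zero := hHLT
  have hE : WeierstrassCurve.hasEntireLFunction_rat := hEnt
  have hGZK' : Literature.NumberTheory.EllipticCurves.rank_eq_analyticRank_of_analyticRank_le_one := hGZK
  haveI : Fact (Nat.Prime 2) := ⟨Nat.prime_two⟩
  haveI : NeZero (W.conductorNorm ℤ) := ⟨(W.conductorNorm_pos_holds).ne'⟩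
  obtain rfl | rfl : r = 0 ∨ r = 1 := by omega
  · -- ===== r = 0 : partner twist with a simple zero (BFH 1990 (i), `2` split) =====
    have hw : W.rootNumber = 1 := by
      have h := hpar W
      unfold Literature.NumberTheory.EllipticCurves.p_parity at h
      rw [hc, pow_zero] at h
      exact h.symm
    obtain ⟨K, _, _, hK, -, hHN, hH2, hd8, hL0, hL1⟩ := hBFH W hw 0
    have hodd : Odd (NumberField.discr K) := by
      rw [Int.odd_iff]; omega
    have hne3 : NumberField.discr K ≠ -3 := by omega
    have hne4 : NumberField.discr K ≠ -4 := by omega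
    have h2d : ¬ ((2 : ℤ) ∣ NumberField.discr K) := by omega
    have hd : (NumberField.discr K : ℚ) ≠ 0 := by exact_mod_cast NumberField.discr_ne_zero K
    haveI := W.isElliptic_quadraticTwist hd
    have hr1 : (W.quadraticTwist (NumberField.discr K : ℚ)).analyticRank = 1 :=
      Literature.NumberTheory.EllipticCurves.analyticRank_eq_one_of_entireLFunction_one_eq_zero_of_deriv_ne_zero
        _ (hE _) hL0 hL1
    obtain ⟨hrk, hsha⟩ := hGZK' (W.quadraticTwist (NumberField.discr K : ℚ)) (le_of_eq hr1)
    rw [hr1] at hrk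
    haveI := hsha
    have hc' : (W.quadraticTwist (NumberField.discr K : ℚ)).selmerCorank 2 = 1 :=
      Literature.NumberTheory.EllipticCurves.selmerCorank_eq_one_of_mordellWeilRank_eq_one_of_finite
        (W.quadraticTwist (NumberField.discr K : ℚ)) 2 hrk inferInstance
    have htor := hT W hsur K hK
    obtain ⟨fW, hfW⟩ := hMod W
    obtain ⟨Dt⟩ :=
      Literature.NumberTheory.Automorphic.nonempty_modularParametrizationData_of_isNewformOf hfW
    obtain ⟨β, hβ⟩ := Literature.NumberTheory.EllipticCurves.exists_dvd_sq_sub_discr_holds (W.conductorNorm ℤ) K hK hHN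
    obtain ⟨ι⟩ := (inferInstance : Nonempty (K →+* ℂ))
    obtain ⟨θ, k, hV2k⟩ := hV2 W hCM hred hsur K hK hne3 hne4 h2d hHN
    obtain ⟨n, d, M, hn, hM1, hMle, hne⟩ :=
      hV1 W hCM hred hsur K hK hHN hodd hne3 htor hH2 Dt β ι hβ θ k
    obtain ⟨n₀, d₀, M₀, hn₀, hM₀, hM₀le, hne₀, hmin⟩ :=
      exists_minimal_kolyvaginClass_ne_zero_theta θ k d hn hM1 hMle hne
    -- the ONLY use of V2 (weakened): the lower bound `ν + 1 ≤ max(c, c') = 1` forces `ν = 0`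
    have hstruct := hV2k Dt β ι n₀ d₀ M₀ hn₀ hM₀ hM₀le hne₀ hmin
    have hν : n₀.primeFactors.card = 0 := by
      rcases hstruct with h1 | h1 <;> omega
    have hn1 : n₀ = 1 := by
      rw [Finset.card_eq_zero, Nat.primeFactors_eq_empty] at hν
      rcases hν with h0 | h1
      · exact absurd (h0 ▸ hn₀.1) not_squarefree_zero
      · exact h1
    subst hn1
    have hEK : Literature.NumberTheory.EllipticCurves.analyticRankEK W K = 1 :=
      Literature.NumberTheory.EllipticCurves.heegnerSystem_analyticRankEK_eq_one_of_kolyvaginClass_one_ne_zero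
        (hGZ W _ K) (hrec _ W K) hK rfl hHN d₀ hne₀
    rw [Literature.NumberTheory.EllipticCurves.analyticRankEK_eq_add_of hE W K, hr1] at hEK
    omega
  · -- ===== r = 1 : partner twist with L(E^{(d_K)}, 1) ≠ 0 (Hoffstein–Luo) =====
    have hw : W.rootNumber = -1 := by
      have h := hpar W
      unfold Literature.NumberTheory.EllipticCurves.p_parity at h
      rw [hc, pow_one] at h
      exact h.symm
    obtain ⟨K, _, _, hK, -, hHN, hH2, hd8, hL1⟩ :=
      Literature.NumberTheory.EllipticCurves.exists_heegnerField_split_twist_ne_zero_discr_emod_eight_of_hoffsteinLuo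
        hmod hHL W hw Nat.prime_two 0
    have hodd : Odd (NumberField.discr K) := by
      rw [Int.odd_iff]; omega
    have hne3 : NumberField.discr K ≠ -3 := by omega
    have hne4 : NumberField.discr K ≠ -4 := by omega
    have h2d : ¬ ((2 : ℤ) ∣ NumberField.discr K) := by omega
    have hd : (NumberField.discr K : ℚ) ≠ 0 := by exact_mod_cast NumberField.discr_ne_zero K
    haveI := W.isElliptic_quadraticTwist hd
    obtain ⟨-, -, hfin⟩ := hKato (W.quadraticTwist (NumberField.discr K : ℚ)) hL1
    haveI := hfin
    have hc' : (W.quadraticTwist (NumberField.discr K : ℚ)).selmerCorank 2 = 0 :=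
      (W.quadraticTwist (NumberField.discr K : ℚ)).selmerCorank_eq_zero_of_finite 2
    have htor := hT W hsur K hK
    obtain ⟨fW, hfW⟩ := hMod W
    obtain ⟨Dt⟩ :=
      Literature.NumberTheory.Automorphic.nonempty_modularParametrizationData_of_isNewformOf hfW
    obtain ⟨β, hβ⟩ := Literature.NumberTheory.EllipticCurves.exists_dvd_sq_sub_discr_holds (W.conductorNorm ℤ) K hK hHN
    obtain ⟨ι⟩ := (inferInstance : Nonempty (K →+* ℂ))
    obtain ⟨θ, k, hV2k⟩ := hV2 W hCM hred hsur K hK hne3 hne4 h2d hHN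
    obtain ⟨n, d, M, hn, hM1, hMle, hne⟩ :=
      hV1 W hCM hred hsur K hK hHN hodd hne3 htor hH2 Dt β ι hβ θ k
    obtain ⟨n₀, d₀, M₀, hn₀, hM₀, hM₀le, hne₀, hmin⟩ :=
      exists_minimal_kolyvaginClass_ne_zero_theta θ k d hn hM1 hMle hne
    -- the ONLY use of V2 (weakened): the lower bound `ν + 1 ≤ max(c, c') = 1` forces `ν = 0`
    have hstruct := hV2k Dt β ι n₀ d₀ M₀ hn₀ hM₀ hM₀le hne₀ hmin
    have hν : n₀.primeFactors.card = 0 := by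
      rcases hstruct with h1 | h1 <;> omega
    have hn1 : n₀ = 1 := by
      rw [Finset.card_eq_zero, Nat.primeFactors_eq_empty] at hν
      rcases hν with h0 | h1
      · exact absurd (h0 ▸ hn₀.1) not_squarefree_zero
      · exact h1
    subst hn1
    have hEK : Literature.NumberTheory.EllipticCurves.analyticRankEK W K = 1 :=
      Literature.NumberTheory.EllipticCurves.heegnerSystem_analyticRankEK_eq_one_of_kolyvaginClass_one_ne_zero
        (hGZ W _ K) (hrec _ W K) hK rfl hHN d₀ hne₀
    rw [Literature.NumberTheory.EllipticCurves.analyticRankEK_eq_add_of hE W K,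
      Literature.NumberTheory.EllipticCurves.analyticRank_eq_zero_of_entireLFunction_one_ne_zero _ hL1,
      add_zero] at hEK
    exact hEK


end Summit.BirchSwinnertonDyer.BirchSwinnertonDyer.Theses.KolyvaginRankRigidityAtTwo.MarginThetaTurnkey
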